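import Summits.BirchSwinnertonDyer.BirchSwinnertonDyer.Theorems.UniversalToricDescentDefectTransportModThreePTOfSigmaCongruence
import Summits.BirchSwinnertonDyer.BirchSwinnertonDyer.Theorems.UniversalToricDescentTorsionMuTransportHeegner
import Summits.BirchSwinnertonDyer.BirchSwinnertonDyer.Theorems.SchneiderFreeAdditiveX3PoitouTateSelmerDualityHolds
import Summits.BirchSwinnertonDyer.BirchSwinnertonDyer.Theorems.UniversalToricDescentPoitouTateShaTateDualFact
import HarnessLib

/-!
# The one-sided defect transport ♭T≤ WITHOUT THE WALL: `μ(X_E) = 0` and `Λ`-torsion of `X_{∅,0}(E/K_∞)` from the TWIN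
# (LEAD bsd-wall-utd-p1 g19, 2026-08-29; helper on the UTD parent node stmt-BirchSwinnertonDyer-20186 / crux ♭T≤ 23042)

The landed composition `…DefectTransportModThreePTOfSigmaCongruence.defectTransportModThreePT_of_sigmaCongruenceAtThree`
(item 27121 ✓) proves ♭T≤ = `DefectTransportModThreePT` from A = `SigmaCongruenceAtThree`; ♭T≤'s text carries two
hypotheses on the WILD curve `E`: `Λ`-torsion of `X := X_{∅,0}(E/K_∞)` (`hT`) and the integral WALL `(𝓛) ⊆ Ch_Λ(X)·R₀⟦T⟧`
(`hle`, item 20395). Inspection of the landed one-sided glue (`…StubOneSidedGlue`, l. 178) shows that the wall is used for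
ONE thing only: `μ(X) = 0` (`muInvariant_eq_zero_of_span_le_map_charIdeal`). Both `hT` and `μ(X) = 0` follow instead from the
TWIN by the residual transfer along `E[3] ≅ E′[3]` (Greenberg–Vatsal Prop. 2.8, this lineage's g6 file
`…TorsionMuTransportHeegner.torsionMuTransportModThree`): if `X′ := X_{∅,0}(E′/K_∞)` is `Λ`-torsion and `Ch_Λ(X′)·R₀⟦T⟧`
has a generator with a norm-one coefficient (e.g. the twin main conjecture `Ch·R₀⟦T⟧ = (𝓛′)` at a frame with `μ(𝓛′) = 0`),
then so does `X`.

All three theorems DISCHARGE ♭T≤'s two Poitou–Tate antecedents by the tree's proofs (items 20461/20462 ✓: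
`SchneiderFreeAdditiveX3.PoitouTateReduction.poitouTate_selmerStructure_duality_holds`, `poitouTateShaTateDualFact_proof`).

* `defectTransportPT_of_mu_of_sigmaCongruence` — the primitive form: ♭T≤'s conclusion VERBATIM from A with the wall `hle`
  REPLACED by `μ(X) = 0` (a generator of `Ch_Λ(X)·R₀⟦T⟧` with a norm-one coefficient; `hT` kept): the landed `oneSidedTransport`
  applied AT `L :=` that generator (its `L` enters only through `hle`/`hi`), then the landed composition verbatim (A at the bad
  set, A at B′'s data for the analytic identity).
* `defectTransportPT_wallFree_of_sigmaCongruence` — ♭T≤'s conclusion VERBATIM (generators `g, g′`, profiles `n, m, n′, m′`,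
  `n′ + m ≤ n + m′`) from A, under ♭T≤'s binders with `hT`/`hle` REPLACED by: `X′` is `Λ`-torsion and `Ch_Λ(X′)·R₀⟦T⟧ = (g′₀)`
  for some `g′₀` with a norm-one coefficient. Proof: `torsionMuTransportModThree` gives `X` torsion and `μ(X) = 0`; then the
  primitive form.
* `defectTransportPT_wallFree_of_sigmaCongruence_of_twinIMC` — the same with the twin input in main-conjecture form
  `Ch_Λ(X′)·R₀⟦T⟧ = (𝓛′)` (`μ(𝓛′) = 0` is already a binder).

USE (parent node 20186, line `ratwall_thin_comb`): with this, the registered stub `stub_invariantsTransport` (= item 20399, the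
TWO-sided `(μ, λ)`-transport, conjecture-grade at `9 ∣ N`) is not needed for the parent's squeeze — rational wall
`3^k·𝓛 ∈ (g)` + `μ(g) = 0` ⇒ `g ∣ 𝓛` ⇒ `n ≤ m`; this file ⇒ `n′ + m ≤ n + m′`; twin main conjecture ⇒ `n′ = m′`; hence `n = m`
and `(g) = (𝓛)` — at the price of ♭T≤'s print binders (Poitou–Tate ×2, base finiteness of `E` at `v ∣ 3`) and A, which the
deciding chain already carries. HONEST FRAMING: conditional on A (hypothesis `hA`, research item 27120); closes nothing by itself;
BSD is not proved by any of this. References: [GreenbergVatsal2000] Thm. (1.4), §2 Prop. (2.8); [LeiMullerXia2023] Thm. 5.1.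
-/

noncomputable section

open scoped Classical

set_option linter.dupNamespace false
set_option autoImplicit false

namespace Summit.BirchSwinnertonDyer.BirchSwinnertonDyer.Theorems.UniversalToricDescentDefectTransportModThreePTWallFree

open PowerSeries WeierstrassCurve NumberField IsDedekindDomain Field Polynomial
  Literature.NumberTheory.EllipticCurves
  Literature.NumberTheory.EllipticCurves.ModularForms
  Literature.NumberTheory.EllipticCurves.Rank1Residual
  Literature.NumberTheory.EllipticCurves.GreenbergSelmer
  Literature.NumberTheory.EllipticCurves.IwasawaAlgebra
  Literature.NumberTheory.GaloisRepresentations Literature.NumberTheory.GaloisCohomology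
  Summit.BirchSwinnertonDyer.Rank1Residual Summit.BirchSwinnertonDyer.Rank1Residual.X11b
  Summit.BirchSwinnertonDyer.Rank1Residual.X11b.AcSelmer Summit.BirchSwinnertonDyer.Rank1Residual.X11b.Coinv
  Summit.BirchSwinnertonDyer.Rank1Residual.Iwasawa
  Summit.BirchSwinnertonDyer.BirchSwinnertonDyer.Theorems
  Summit.BirchSwinnertonDyer.BirchSwinnertonDyer.Theorems.SchneiderFree
  Summit.BirchSwinnertonDyer.BirchSwinnertonDyer.Theorems.UniversalToricDescentDefectTransport
  Summit.BirchSwinnertonDyer.BirchSwinnertonDyer.Theorems.UniversalToricDescentNormProfile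
  Summit.BirchSwinnertonDyer.BirchSwinnertonDyer.Theorems.UniversalToricDescentSigmaLocalStabilizer
  Summit.BirchSwinnertonDyer.BirchSwinnertonDyer.Theorems.UniversalToricDescentDefectTransportModThreePTOfSigmaCongruence
  Summit.BirchSwinnertonDyer.BirchSwinnertonDyer.Cruxes.DefectTransportModThreePT.SigmaCongruence

/-- **♭T≤ from `μ(X_E) = 0`** (the primitive wall-free form): ♭T≤'s conclusion from A = `SigmaCongruenceAtThree`, `Λ`-torsion of
`X := X_{∅,0}(E/K_∞)` and a generator of `Ch_Λ(X)·R₀⟦T⟧` with a norm-one coefficient (`μ(X) = 0`) IN PLACE OF the wall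
`(𝓛) ⊆ Ch_Λ(X)·R₀⟦T⟧`, under ♭T≤'s remaining binders. The landed `oneSidedTransport` is applied at `L :=` that generator.
[cite: GreenbergVatsal2000, Thm. (1.4), §2 Prop. (2.1), Cor. (2.3), Prop. (2.8)] [cite: LeiMullerXia2023, Thm. 5.1] -/
theorem defectTransportPT_of_mu_of_sigmaCongruence
    (hA : Summit.BirchSwinnertonDyer.BirchSwinnertonDyer.Theses.UniversalToricDescent.SigmaCongruenceAtThree) :
    ∀ (W : WeierstrassCurve ℚ) [W.IsElliptic] [W.IsGloballyMinimal] (W' : WeierstrassCurve ℚ) [W'.IsElliptic]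
      [W'.IsGloballyMinimal] (N N' : ℕ) [NeZero N] [NeZero N'] (K : Type) [Field K] [NumberField K]
      (Dt : ModularParametrizationData W N) (Dt' : ModularParametrizationData W' N'),
      Additive.ClassO6 W 3 → W.HasSurjectiveModNGaloisRep 3 → W.analyticRank = 1 → W.conductorNorm ℤ = N →
      O6.ModPCongruent W' W 3 → ¬ Addv W' 3 → W'.conductorNorm ℤ = N' → IsImaginaryQuadratic K →
      SatisfiesHeegnerHypothesis N K → SatisfiesHeegnerHypothesis N' K →
      (∀ v : HeightOneSpectrum (𝓞 K), ((3 : ℕ) : 𝓞 K) ∈ v.asIdeal → Finite (selmerAcBase (W.baseChange K) 3 v ∅)) →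
      ∀ (κ : ZpExtension K 3), κ.IsAnticyclotomic → ∀ (γ : absoluteGaloisGroup K) [Fact (κ.IsTopGenerator γ)]
      (𝔭 𝔭' : HeightOneSpectrum (𝓞 K)), ((3 : ℕ) : 𝓞 K) ∈ 𝔭.asIdeal → 𝔭.asIdeal.ramificationIdx (𝓞 ℚ) = 1 →
      𝔭.asIdeal.inertiaDeg (𝓞 ℚ) = 1 → ((3 : ℕ) : 𝓞 K) ∈ 𝔭'.asIdeal → 𝔭' ≠ 𝔭 →
      ∀ (ι' : PadicAlgCl 3 ≃+* ℂ), BranchInducesPrime 3 ι' 𝔭 →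
      Module.IsTorsion (IwasawaAlgebra 3) (XAc (W.baseChange K) 3 κ 𝔭' ∅ γ) →
      (∃ g₀ : UnrSeries 3,
        (XAc.charIdeal (W.baseChange K) 3 κ 𝔭' ∅ γ).map (PowerSeries.map (Halves.toUnr 3)) = Ideal.span {g₀} ∧
          ∃ i : ℕ, ‖((PowerSeries.coeff i g₀ : unrIntegers 3) : ℂ_[3])‖ = 1) →
      ∀ (ΩK : ℂ) (Ωp : ℂ_[3]) (L : UnrSeries 3), ΩK ≠ 0 → Ωp ≠ 0 → IsBDPLFunction ι' 𝔭 κ γ Dt.f ΩK Ωp L →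
      ∀ (ΩK' : ℂ) (Ωp' : ℂ_[3]) (L' : UnrSeries 3), ΩK' ≠ 0 → Ωp' ≠ 0 → IsBDPLFunction ι' 𝔭 κ γ Dt'.f ΩK' Ωp' L' →
      (∃ i : ℕ, ‖((PowerSeries.coeff i L' : unrIntegers 3) : ℂ_[3])‖ = 1) →
      ∃ (g g' : UnrSeries 3) (n m n' m' : ℕ),
        (XAc.charIdeal (W.baseChange K) 3 κ 𝔭' ∅ γ).map (PowerSeries.map (Halves.toUnr 3)) = Ideal.span {g} ∧
        (XAc.charIdeal (W'.baseChange K) 3 κ 𝔭' ∅ γ).map (PowerSeries.map (Halves.toUnr 3)) = Ideal.span {g'} ∧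
        ((∀ i < n, ‖((PowerSeries.coeff i g : unrIntegers 3) : ℂ_[3])‖ < 1) ∧
          ‖((PowerSeries.coeff n g : unrIntegers 3) : ℂ_[3])‖ = 1) ∧
        ((∀ i < m, ‖((PowerSeries.coeff i L : unrIntegers 3) : ℂ_[3])‖ < 1) ∧
          ‖((PowerSeries.coeff m L : unrIntegers 3) : ℂ_[3])‖ = 1) ∧
        ((∀ i < n', ‖((PowerSeries.coeff i g' : unrIntegers 3) : ℂ_[3])‖ < 1) ∧
          ‖((PowerSeries.coeff n' g' : unrIntegers 3) : ℂ_[3])‖ = 1) ∧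
        ((∀ i < m', ‖((PowerSeries.coeff i L' : unrIntegers 3) : ℂ_[3])‖ < 1) ∧
          ‖((PowerSeries.coeff m' L' : unrIntegers 3) : ℂ_[3])‖ = 1) ∧
        n' + m ≤ n + m' := by
  intro W _ _ W' _ _ N N' _ _ K _ _ Dt Dt' hO6 hsurj hr hN hcong hadd hN' hK hHe hHe' hfinE κ hκ γ _ 𝔭 𝔭' h𝔭 he
    hf h𝔭' hne ι' hbr hT hμ ΩK Ωp L hΩK hΩp hL ΩK' Ωp' L' hΩK' hΩp' hL' hi'
  haveI : Fact (Nat.Prime 3) := ⟨Nat.prime_three⟩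
  obtain ⟨g₀, hg₀, hi₀⟩ := hμ
  have hle₀ : Ideal.span {g₀} ≤ (XAc.charIdeal (W.baseChange K) 3 κ 𝔭' ∅ γ).map (PowerSeries.map (Halves.toUnr 3)) :=
    hg₀ ▸ le_rfl
  -- A at `(𝓛, 𝓛′)`
  have hAL := hA W W' N N' K Dt Dt' hO6 hsurj hr hN hcong hadd hN' hK hHe hHe' κ hκ γ 𝔭 h𝔭 he hf
    𝔭' h𝔭' hne ι' hbr ΩK Ωp L hΩK hΩp hL ΩK' Ωp' L' hΩK' hΩp' hL' hi'
  -- B′ at `L := g₀` (the wall hypothesis of the landed one-sided transport holds trivially for the generator itself)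
  obtain ⟨T, c, s, s', hTS, hdata, ⟨g, hg, hglt, hgeq⟩, -, ⟨g', hg', hglt', hgeq'⟩, hsum⟩ :=
    oneSidedTransport (fun K _ _ ↦ SchneiderFreeAdditiveX3.PoitouTateReduction.poitouTate_selmerStructure_duality_holds K)
      poitouTateShaTateDualFact_proof W W' N N' K hO6 hsurj hr hN hcong hadd hN' hK hHe hHe' hfinE κ hκ γ 𝔭' h𝔭' hT g₀
      hle₀ hi₀
  have hTp : ∀ v ∈ T, ((3 : ℕ) : 𝓞 K) ∉ v.asIdeal := fun v hv ↦ by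
    have h : v ∈ (↑T : Set (HeightOneSpectrum (𝓞 K))) := Finset.mem_coe.mpr hv
    rw [hTS] at h
    exact h.1
  -- A at B′'s data: `μ(𝓛) = 0`, the norm profiles of `𝓛`, `𝓛′` and the analytic identity `m + Σ = m′ + Σ′`
  obtain ⟨e, u, hu, he', hcongT⟩ := hAL T c hTS (fun v hv ↦ ⟨(hdata v hv).1, (hdata v hv).2.1⟩)
  obtain ⟨m, m', hm, hm', hsum'⟩ :=
    analyticIdentity_of_sigmaCongruence W W' K κ T c s s' hTp hdata e he' hi' hu hcongT
  exact ⟨g, g', _, m, _, m', hg, hg', ⟨hglt, hgeq⟩, hm, ⟨hglt', hgeq'⟩, hm', by omega⟩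

/-- **♭T≤ without the wall** (and without the wild torsion binder): ♭T≤'s conclusion from A = `SigmaCongruenceAtThree`, the twin's
`Λ`-torsion and a generator of `Ch_Λ(X_{∅,0}(E′/K_∞))·R₀⟦T⟧` with a norm-one coefficient, under ♭T≤'s remaining binders.
[cite: GreenbergVatsal2000, Thm. (1.4), §2 Prop. (2.1), Cor. (2.3), Prop. (2.8)] [cite: LeiMullerXia2023, Thm. 5.1] -/
theorem defectTransportPT_wallFree_of_sigmaCongruence
    (hA : Summit.BirchSwinnertonDyer.BirchSwinnertonDyer.Theses.UniversalToricDescent.SigmaCongruenceAtThree) :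
    ∀ (W : WeierstrassCurve ℚ) [W.IsElliptic] [W.IsGloballyMinimal] (W' : WeierstrassCurve ℚ) [W'.IsElliptic]
      [W'.IsGloballyMinimal] (N N' : ℕ) [NeZero N] [NeZero N'] (K : Type) [Field K] [NumberField K]
      (Dt : ModularParametrizationData W N) (Dt' : ModularParametrizationData W' N'),
      Additive.ClassO6 W 3 → W.HasSurjectiveModNGaloisRep 3 → W.analyticRank = 1 → W.conductorNorm ℤ = N →
      O6.ModPCongruent W' W 3 → ¬ Addv W' 3 → W'.conductorNorm ℤ = N' → IsImaginaryQuadratic K →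
      SatisfiesHeegnerHypothesis N K → SatisfiesHeegnerHypothesis N' K →
      (∀ v : HeightOneSpectrum (𝓞 K), ((3 : ℕ) : 𝓞 K) ∈ v.asIdeal → Finite (selmerAcBase (W.baseChange K) 3 v ∅)) →
      ∀ (κ : ZpExtension K 3), κ.IsAnticyclotomic → ∀ (γ : absoluteGaloisGroup K) [Fact (κ.IsTopGenerator γ)]
      (𝔭 𝔭' : HeightOneSpectrum (𝓞 K)), ((3 : ℕ) : 𝓞 K) ∈ 𝔭.asIdeal → 𝔭.asIdeal.ramificationIdx (𝓞 ℚ) = 1 →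
      𝔭.asIdeal.inertiaDeg (𝓞 ℚ) = 1 → ((3 : ℕ) : 𝓞 K) ∈ 𝔭'.asIdeal → 𝔭' ≠ 𝔭 →
      ∀ (ι' : PadicAlgCl 3 ≃+* ℂ), BranchInducesPrime 3 ι' 𝔭 →
      Module.IsTorsion (IwasawaAlgebra 3) (XAc (W'.baseChange K) 3 κ 𝔭' ∅ γ) →
      (∃ g'₀ : UnrSeries 3,
        (XAc.charIdeal (W'.baseChange K) 3 κ 𝔭' ∅ γ).map (PowerSeries.map (Halves.toUnr 3)) = Ideal.span {g'₀} ∧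
          ∃ i : ℕ, ‖((PowerSeries.coeff i g'₀ : unrIntegers 3) : ℂ_[3])‖ = 1) →
      ∀ (ΩK : ℂ) (Ωp : ℂ_[3]) (L : UnrSeries 3), ΩK ≠ 0 → Ωp ≠ 0 → IsBDPLFunction ι' 𝔭 κ γ Dt.f ΩK Ωp L →
      ∀ (ΩK' : ℂ) (Ωp' : ℂ_[3]) (L' : UnrSeries 3), ΩK' ≠ 0 → Ωp' ≠ 0 → IsBDPLFunction ι' 𝔭 κ γ Dt'.f ΩK' Ωp' L' →
      (∃ i : ℕ, ‖((PowerSeries.coeff i L' : unrIntegers 3) : ℂ_[3])‖ = 1) →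
      ∃ (g g' : UnrSeries 3) (n m n' m' : ℕ),
        (XAc.charIdeal (W.baseChange K) 3 κ 𝔭' ∅ γ).map (PowerSeries.map (Halves.toUnr 3)) = Ideal.span {g} ∧
        (XAc.charIdeal (W'.baseChange K) 3 κ 𝔭' ∅ γ).map (PowerSeries.map (Halves.toUnr 3)) = Ideal.span {g'} ∧
        ((∀ i < n, ‖((PowerSeries.coeff i g : unrIntegers 3) : ℂ_[3])‖ < 1) ∧
          ‖((PowerSeries.coeff n g : unrIntegers 3) : ℂ_[3])‖ = 1) ∧
        ((∀ i < m, ‖((PowerSeries.coeff i L : unrIntegers 3) : ℂ_[3])‖ < 1) ∧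
          ‖((PowerSeries.coeff m L : unrIntegers 3) : ℂ_[3])‖ = 1) ∧
        ((∀ i < n', ‖((PowerSeries.coeff i g' : unrIntegers 3) : ℂ_[3])‖ < 1) ∧
          ‖((PowerSeries.coeff n' g' : unrIntegers 3) : ℂ_[3])‖ = 1) ∧
        ((∀ i < m', ‖((PowerSeries.coeff i L' : unrIntegers 3) : ℂ_[3])‖ < 1) ∧
          ‖((PowerSeries.coeff m' L' : unrIntegers 3) : ℂ_[3])‖ = 1) ∧
        n' + m ≤ n + m' := by
  intro W _ _ W' _ _ N N' _ _ K _ _ Dt Dt' hO6 hsurj hr hN hcong hadd hN' hK hHe hHe' hfinE κ hκ γ _ 𝔭 𝔭' h𝔭 he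
    hf h𝔭' hne ι' hbr hT' hμ' ΩK Ωp L hΩK hΩp hL ΩK' Ωp' L' hΩK' hΩp' hL' hi'
  -- torsion and `μ = 0` of the wild `X_{∅,0}(E/K_∞)` FROM THE TWIN (GV Prop. 2.8 along `E[3] ≅ E′[3]`)
  obtain ⟨hT, hμ⟩ :=
    UniversalToricDescentTorsionMuTransportHeegner.torsionMuTransportModThree W W' K hN hcong hN' hK hHe hHe' κ hκ γ 𝔭'
      h𝔭' hT' hμ'
  exact defectTransportPT_of_mu_of_sigmaCongruence hA W W' N N' K Dt Dt' hO6 hsurj hr hN hcong hadd hN' hK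
    hHe hHe' hfinE κ hκ γ 𝔭 𝔭' h𝔭 he hf h𝔭' hne ι' hbr hT hμ ΩK Ωp L hΩK hΩp hL ΩK' Ωp' L' hΩK' hΩp' hL' hi'

/-- **♭T≤ without the wall, twin input in main-conjecture form**: as `defectTransportPT_wallFree_of_sigmaCongruence`, with the
twin's generator hypothesis replaced by `Ch_Λ(X_{∅,0}(E′/K_∞))·R₀⟦T⟧ = (𝓛′)` at the frame `𝓛′` (whose `μ = 0` is a binder).
[cite: GreenbergVatsal2000, Thm. (1.4), §2 Prop. (2.8)] -/
theorem defectTransportPT_wallFree_of_sigmaCongruence_of_twinIMC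
    (hA : Summit.BirchSwinnertonDyer.BirchSwinnertonDyer.Theses.UniversalToricDescent.SigmaCongruenceAtThree) :
    ∀ (W : WeierstrassCurve ℚ) [W.IsElliptic] [W.IsGloballyMinimal] (W' : WeierstrassCurve ℚ) [W'.IsElliptic]
      [W'.IsGloballyMinimal] (N N' : ℕ) [NeZero N] [NeZero N'] (K : Type) [Field K] [NumberField K]
      (Dt : ModularParametrizationData W N) (Dt' : ModularParametrizationData W' N'),
      Additive.ClassO6 W 3 → W.HasSurjectiveModNGaloisRep 3 → W.analyticRank = 1 → W.conductorNorm ℤ = N →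
      O6.ModPCongruent W' W 3 → ¬ Addv W' 3 → W'.conductorNorm ℤ = N' → IsImaginaryQuadratic K →
      SatisfiesHeegnerHypothesis N K → SatisfiesHeegnerHypothesis N' K →
      (∀ v : HeightOneSpectrum (𝓞 K), ((3 : ℕ) : 𝓞 K) ∈ v.asIdeal → Finite (selmerAcBase (W.baseChange K) 3 v ∅)) →
      ∀ (κ : ZpExtension K 3), κ.IsAnticyclotomic → ∀ (γ : absoluteGaloisGroup K) [Fact (κ.IsTopGenerator γ)]
      (𝔭 𝔭' : HeightOneSpectrum (𝓞 K)), ((3 : ℕ) : 𝓞 K) ∈ 𝔭.asIdeal → 𝔭.asIdeal.ramificationIdx (𝓞 ℚ) = 1 →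
      𝔭.asIdeal.inertiaDeg (𝓞 ℚ) = 1 → ((3 : ℕ) : 𝓞 K) ∈ 𝔭'.asIdeal → 𝔭' ≠ 𝔭 →
      ∀ (ι' : PadicAlgCl 3 ≃+* ℂ), BranchInducesPrime 3 ι' 𝔭 →
      Module.IsTorsion (IwasawaAlgebra 3) (XAc (W'.baseChange K) 3 κ 𝔭' ∅ γ) →
      ∀ (ΩK : ℂ) (Ωp : ℂ_[3]) (L : UnrSeries 3), ΩK ≠ 0 → Ωp ≠ 0 → IsBDPLFunction ι' 𝔭 κ γ Dt.f ΩK Ωp L →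
      ∀ (ΩK' : ℂ) (Ωp' : ℂ_[3]) (L' : UnrSeries 3), ΩK' ≠ 0 → Ωp' ≠ 0 → IsBDPLFunction ι' 𝔭 κ γ Dt'.f ΩK' Ωp' L' →
      (XAc.charIdeal (W'.baseChange K) 3 κ 𝔭' ∅ γ).map (PowerSeries.map (Halves.toUnr 3)) = Ideal.span {L'} →
      (∃ i : ℕ, ‖((PowerSeries.coeff i L' : unrIntegers 3) : ℂ_[3])‖ = 1) →
      ∃ (g g' : UnrSeries 3) (n m n' m' : ℕ),
        (XAc.charIdeal (W.baseChange K) 3 κ 𝔭' ∅ γ).map (PowerSeries.map (Halves.toUnr 3)) = Ideal.span {g} ∧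
        (XAc.charIdeal (W'.baseChange K) 3 κ 𝔭' ∅ γ).map (PowerSeries.map (Halves.toUnr 3)) = Ideal.span {g'} ∧
        ((∀ i < n, ‖((PowerSeries.coeff i g : unrIntegers 3) : ℂ_[3])‖ < 1) ∧
          ‖((PowerSeries.coeff n g : unrIntegers 3) : ℂ_[3])‖ = 1) ∧
        ((∀ i < m, ‖((PowerSeries.coeff i L : unrIntegers 3) : ℂ_[3])‖ < 1) ∧
          ‖((PowerSeries.coeff m L : unrIntegers 3) : ℂ_[3])‖ = 1) ∧
        ((∀ i < n', ‖((PowerSeries.coeff i g' : unrIntegers 3) : ℂ_[3])‖ < 1) ∧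
          ‖((PowerSeries.coeff n' g' : unrIntegers 3) : ℂ_[3])‖ = 1) ∧
        ((∀ i < m', ‖((PowerSeries.coeff i L' : unrIntegers 3) : ℂ_[3])‖ < 1) ∧
          ‖((PowerSeries.coeff m' L' : unrIntegers 3) : ℂ_[3])‖ = 1) ∧
        n' + m ≤ n + m' := by
  intro W _ _ W' _ _ N N' _ _ K _ _ Dt Dt' hO6 hsurj hr hN hcong hadd hN' hK hHe hHe' hfinE κ hκ γ _ 𝔭 𝔭' h𝔭 he
    hf h𝔭' hne ι' hbr hT' ΩK Ωp L hΩK hΩp hL ΩK' Ωp' L' hΩK' hΩp' hL' heq' hi'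
  exact defectTransportPT_wallFree_of_sigmaCongruence hA W W' N N' K Dt Dt' hO6 hsurj hr hN hcong hadd hN' hK
    hHe hHe' hfinE κ hκ γ 𝔭 𝔭' h𝔭 he hf h𝔭' hne ι' hbr hT' ⟨L', heq', hi'⟩ ΩK Ωp L hΩK hΩp hL ΩK' Ωp' L' hΩK' hΩp' hL'
    hi'

end Summit.BirchSwinnertonDyer.BirchSwinnertonDyer.Theorems.UniversalToricDescentDefectTransportModThreePTWallFree

end
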